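import Literature.NumberTheory.LFunctions.ConreyIwaniec2002SpacingMechanism
import HarnessLib

/-!
# Conrey–Iwaniec (2002), §9: the mollifier identity `M(s)N(s) = 1 + B₁(s) + B₂(s)`

Conrey–Iwaniec, *Spacing of zeros of Hecke L-functions and the class number problem*, Acta Arith.
103 (2002), §9, (9.1)–(9.5) and p. 20 L1–8 [held text `paper:arxiv-math_0111012`, p0020]: with
`N(s) = Σ_{n ≤ q⁴} λ(n) n^{−s}` (8.8) and the mollifier `M(s) = Σ_{m ≤ q⁴} λ*(m) m^{−s}` (9.5), the
Möbius relation `Σ_{mn = ℓ} λ*(m)λ(n) = [ℓ = 1]` (`λ* ∗ λ = δ`, the tree's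
`sum_divisorsAntidiagonal_twistMoebius_mul_twistCount`) gives
`M(s)N(s) = 1 + B(s)`, `B(s) = Σ_{m,n ≤ q⁴, mn > q⁴} λ*(m)λ(n)(mn)^{−s}`, and "the condition
`mn > q⁴` implies that either `m` or `n` is larger than `q²`": `B = B₁ + B₂` with `m > q²` in `B₁`
and `m ≤ q²` (whence `n > q²`) in `B₂`.

PROVED HERE (no named fact): the generic hyperbola splitting of a product of two finite Dirichlet
polynomials (`sum_Icc_mul_sum_Icc_eq_sum_divisorsAntidiagonal_add`, pure finite-sum algebra) and the
identity `ConreyIwaniec2002.shortInvSum_mul_shortLSum_sub_one` = stub S7 `stub_mollifier_identity`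
of the I6b skeleton `prop81-moebius-perron` (signature verbatim).

## References

* [ConreyIwaniec2002] B. Conrey, H. Iwaniec, Acta Arith. 103 (2002) 259–312, arXiv:math/0111012:
  §9 (9.1)–(9.5), p. 20 L1–8 (proof of Proposition 9.1).
-/

noncomputable section

open scoped NumberField
open Complex

namespace Literature.NumberTheory.LFunctions

namespace ConreyIwaniec2002

open NumberField

/-! ### Generic finite-sum algebra: splitting a product of two Dirichlet polynomials at `mn = N` -/

/-- For `1 ≤ ℓ ≤ N`, the pairs `(m, n) ∈ [1, N]²` with `mn ≤ N` and `mn = ℓ` are exactly the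
divisor pairs of `ℓ` (private plumbing). [folklore] -/
private theorem filter_Icc_prod_Icc_mul_eq_divisorsAntidiagonal {N l : ℕ} (hl : l ∈ Finset.Icc 1 N) :
    ((Finset.Icc 1 N ×ˢ Finset.Icc 1 N).filter (fun p : ℕ × ℕ => p.1 * p.2 ≤ N)).filter
        (fun p : ℕ × ℕ => p.1 * p.2 = l) = l.divisorsAntidiagonal := by
  rw [Finset.mem_Icc] at hl
  ext p
  simp only [Finset.mem_filter, Finset.mem_product, Finset.mem_Icc, Nat.mem_divisorsAntidiagonal]
  constructor
  · exact fun h => ⟨h.2, by omega⟩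
  · rintro ⟨hp, -⟩
    have h1 : 0 < p.1 := Nat.pos_of_ne_zero fun h => by rw [h, zero_mul] at hp; omega
    have h2 : 0 < p.2 := Nat.pos_of_ne_zero fun h => by rw [h, mul_zero] at hp; omega
    have h3 : p.1 ≤ p.1 * p.2 := Nat.le_mul_of_pos_right _ h2
    have h4 : p.2 ≤ p.1 * p.2 := Nat.le_mul_of_pos_left _ h1
    exact ⟨⟨⟨⟨h1, by omega⟩, h2, by omega⟩, by omega⟩, hp⟩

/-- **Hyperbola splitting of a product of two finite Dirichlet polynomials**: for coefficients
`a, b` on `[1, N]`,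
`(Σ_{m ≤ N} a_m)(Σ_{n ≤ N} b_n) = Σ_{ℓ ≤ N} Σ_{mn = ℓ} a_m b_n + Σ_{m, n ≤ N, mn > N} a_m b_n`
(the terms with `mn ≤ N` regrouped along the hyperbolas `mn = ℓ`) — the generic form of the
step `M(s)N(s) = 1 + B(s)` of the source (there with `a_m = λ*(m)m^{−s}`, `b_n = λ(n)n^{−s}`,
`N = q⁴`). [cite: ConreyIwaniec2002, §9 p. 20 L1–8 (proof of Proposition 9.1)] -/
theorem sum_Icc_mul_sum_Icc_eq_sum_divisorsAntidiagonal_add {R : Type*} [CommSemiring R]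
    (a b : ℕ → R) (N : ℕ) :
    (∑ m ∈ Finset.Icc 1 N, a m) * (∑ n ∈ Finset.Icc 1 N, b n) =
      (∑ l ∈ Finset.Icc 1 N, ∑ p ∈ l.divisorsAntidiagonal, a p.1 * b p.2) +
      ∑ m ∈ Finset.Icc 1 N, ∑ n ∈ Finset.Icc 1 N, if N < m * n then a m * b n else 0 := by
  classical
  rw [Finset.sum_mul_sum]
  -- split every term according to `mn ≤ N` / `mn > N`
  have hsplit : ∀ m n : ℕ, a m * b n =
      (if m * n ≤ N then a m * b n else 0) + (if N < m * n then a m * b n else 0) := by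
    intro m n
    by_cases h : m * n ≤ N
    · rw [if_pos h, if_neg (not_lt.mpr h), add_zero]
    · rw [if_neg h, if_pos (not_le.mp h), zero_add]
  rw [Finset.sum_congr rfl fun m _ => Finset.sum_congr rfl fun n _ => hsplit m n]
  simp only [Finset.sum_add_distrib]
  congr 1
  -- the part `mn ≤ N`, regrouped along `mn = ℓ`
  rw [← Finset.sum_product' (f := fun m n => if m * n ≤ N then a m * b n else 0),
    ← Finset.sum_filter]
  have hmaps : ∀ p ∈ (Finset.Icc 1 N ×ˢ Finset.Icc 1 N).filter (fun p : ℕ × ℕ => p.1 * p.2 ≤ N),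
      p.1 * p.2 ∈ Finset.Icc 1 N := by
    intro p hp
    simp only [Finset.mem_filter, Finset.mem_product, Finset.mem_Icc] at hp
    rw [Finset.mem_Icc]
    exact ⟨Nat.one_le_iff_ne_zero.mpr (Nat.mul_ne_zero (by omega) (by omega)), hp.2⟩
  rw [← Finset.sum_fiberwise_of_maps_to hmaps]
  refine Finset.sum_congr rfl fun l hl => ?_
  rw [filter_Icc_prod_Icc_mul_eq_divisorsAntidiagonal hl]

/-- Splitting `[1, N]` at `Q ≤ N`: `Σ_{1 ≤ m ≤ N} = Σ_{1 ≤ m ≤ Q} + Σ_{Q < m ≤ N}` (private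
plumbing). [folklore] -/
private theorem sum_Icc_eq_sum_Icc_add_sum_Icc {R : Type*} [AddCommMonoid R] (F : ℕ → R) {Q N : ℕ}
    (hQN : Q ≤ N) :
    ∑ m ∈ Finset.Icc 1 N, F m = ∑ m ∈ Finset.Icc 1 Q, F m + ∑ m ∈ Finset.Icc (Q + 1) N, F m := by
  rw [← Finset.sum_filter_add_sum_filter_not (Finset.Icc 1 N) (fun m => m ≤ Q)]
  congr 1
  · refine Finset.sum_congr ?_ fun _ _ => rfl
    ext m
    simp only [Finset.mem_filter, Finset.mem_Icc]
    omega
  · refine Finset.sum_congr ?_ fun _ _ => rfl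
    ext m
    simp only [Finset.mem_filter, Finset.mem_Icc]
    omega

/-! ### The identity `M(s)N(s) − 1 = B₁(s) + B₂(s)` -/

variable (K : Type) [Field K] [NumberField K]

/-- **`M(s)N(s) = 1 + B₁(s) + B₂(s)`** (Conrey–Iwaniec 2002, §9, p. 20 L1–8): Möbius inversion
`Σ_{mn = ℓ} λ*(m)λ(n) = [ℓ = 1]` over `m, n ≤ q⁴` leaves exactly the terms `mn > q⁴`
(`B(s) = Σ_{m,n ≤ q⁴, mn > q⁴} λ*(m) m^{−s} λ(n) n^{−s}`), split by `m > q²` (`B₁`) / `m ≤ q²`,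
whence `n > q²` (`B₂`). This is stub S7 `stub_mollifier_identity` of the I6b skeleton
`prop81-moebius-perron` (signature verbatim). [cite: ConreyIwaniec2002, §9 (9.1)–(9.5) and p. 20 L1–8] -/
theorem shortInvSum_mul_shortLSum_sub_one (ψ : ClassGroup (𝓞 K) →* ℂˣ) (q : ℕ) (hq : 0 < q)
    (s : ℂ) :
    shortInvSum K ψ q s * shortLSum K ψ q s - 1 =
      (∑ m ∈ Finset.Icc (q ^ 2 + 1) (q ^ 4), ∑ n ∈ Finset.Icc 1 (q ^ 4),
        if q ^ 4 < m * n then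
          twistMoebius K (classGroupCharIdealHom ψ) m * (m : ℂ) ^ (-s) *
            (twistCount K (classGroupCharIdealHom ψ) n * (n : ℂ) ^ (-s))
        else 0) +
      (∑ m ∈ Finset.Icc 1 (q ^ 2), ∑ n ∈ Finset.Icc (q ^ 2 + 1) (q ^ 4),
        if q ^ 4 < m * n then
          twistMoebius K (classGroupCharIdealHom ψ) m * (m : ℂ) ^ (-s) *
            (twistCount K (classGroupCharIdealHom ψ) n * (n : ℂ) ^ (-s))
        else 0) := by
  classical
  set ν := classGroupCharIdealHom ψ with hν
  -- the two ranges
  have hQN : q ^ 2 ≤ q ^ 4 := Nat.pow_le_pow_right hq (by norm_num)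
  have hN1 : 1 ≤ q ^ 4 := Nat.one_le_pow _ _ hq
  -- `M(s)N(s) = Σ_ℓ [ℓ = 1] ℓ^{-s} + B(s)`
  have key := sum_Icc_mul_sum_Icc_eq_sum_divisorsAntidiagonal_add
    (fun m => twistMoebius K ν m * (m : ℂ) ^ (-s)) (fun n => twistCount K ν n * (n : ℂ) ^ (-s))
    (q ^ 4)
  -- the Möbius part equals `1`
  have hmob : ∑ l ∈ Finset.Icc 1 (q ^ 4), ∑ p ∈ l.divisorsAntidiagonal,
      twistMoebius K ν p.1 * (p.1 : ℂ) ^ (-s) * (twistCount K ν p.2 * (p.2 : ℂ) ^ (-s)) = 1 := by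
    have hl : ∀ l ∈ Finset.Icc 1 (q ^ 4), ∑ p ∈ l.divisorsAntidiagonal,
        twistMoebius K ν p.1 * (p.1 : ℂ) ^ (-s) * (twistCount K ν p.2 * (p.2 : ℂ) ^ (-s)) =
          if l = 1 then 1 else 0 := by
      intro l hl
      rw [Finset.mem_Icc] at hl
      have hl0 : l ≠ 0 := by omega
      have hterm : ∀ p ∈ l.divisorsAntidiagonal,
          twistMoebius K ν p.1 * (p.1 : ℂ) ^ (-s) * (twistCount K ν p.2 * (p.2 : ℂ) ^ (-s)) =
            twistMoebius K ν p.1 * twistCount K ν p.2 * (l : ℂ) ^ (-s) := by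
        intro p hp
        rw [← (Nat.mem_divisorsAntidiagonal.mp hp).1, Nat.cast_mul, natCast_mul_natCast_cpow]
        ring
      rw [Finset.sum_congr rfl hterm, ← Finset.sum_mul,
        sum_divisorsAntidiagonal_twistMoebius_mul_twistCount hl0]
      split_ifs with h1
      · rw [h1, Nat.cast_one, one_cpow, one_mul]
      · rw [zero_mul]
    rw [Finset.sum_congr rfl hl, Finset.sum_ite_eq' (Finset.Icc 1 (q ^ 4)) 1 (fun _ => (1 : ℂ)),
      if_pos (Finset.mem_Icc.mpr ⟨le_rfl, hN1⟩)]
  -- the `m ≤ q²` block: the terms with `n ≤ q²` vanish since then `mn ≤ q⁴`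
  have hB₂ : ∀ m ∈ Finset.Icc 1 (q ^ 2), ∑ n ∈ Finset.Icc 1 (q ^ 4),
      (if q ^ 4 < m * n then
        twistMoebius K ν m * (m : ℂ) ^ (-s) * (twistCount K ν n * (n : ℂ) ^ (-s)) else 0) =
      ∑ n ∈ Finset.Icc (q ^ 2 + 1) (q ^ 4),
      (if q ^ 4 < m * n then
        twistMoebius K ν m * (m : ℂ) ^ (-s) * (twistCount K ν n * (n : ℂ) ^ (-s)) else 0) := by
    intro m hm
    rw [Finset.mem_Icc] at hm
    rw [sum_Icc_eq_sum_Icc_add_sum_Icc _ hQN, Finset.sum_eq_zero, zero_add]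
    intro n hn
    rw [Finset.mem_Icc] at hn
    have hmn : m * n ≤ q ^ 4 := by
      calc m * n ≤ q ^ 2 * q ^ 2 := Nat.mul_le_mul hm.2 hn.2
        _ = q ^ 4 := by rw [← pow_add]
    rw [if_neg (not_lt.mpr hmn)]
  -- assemble
  unfold shortInvSum shortLSum
  rw [key, hmob, add_sub_cancel_left, sum_Icc_eq_sum_Icc_add_sum_Icc _ hQN,
    Finset.sum_congr rfl hB₂, add_comm]

/-- **`M(s)N(s) = 1 + B(s)`, `B(s) = Σ_{m,n ≤ q⁴, mn > q⁴} λ*(m) m^{−s} λ(n) n^{−s}`** (Conrey–Iwaniec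
2002, §9, p. 20 L1–4), the un-split form: Möbius inversion `Σ_{mn = ℓ} λ*(m)λ(n) = [ℓ = 1]` over
`m, n ≤ q⁴` leaves exactly the terms with `mn > q⁴`. (Helper (b) of the I6-ii line
`prop81-perron-bilinear`; the split form `B = B₁ + B₂` is `shortInvSum_mul_shortLSum_sub_one`.)
[cite: ConreyIwaniec2002, §9 (9.1)–(9.5) and p. 20 L1–4] -/
theorem shortInvSum_mul_shortLSum_eq_one_add (ψ : ClassGroup (𝓞 K) →* ℂˣ) (q : ℕ) (hq : 0 < q)
    (s : ℂ) :
    shortInvSum K ψ q s * shortLSum K ψ q s =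
      1 + ∑ m ∈ Finset.Icc 1 (q ^ 4), ∑ n ∈ Finset.Icc 1 (q ^ 4),
        if q ^ 4 < m * n then
          twistMoebius K (classGroupCharIdealHom ψ) m * (m : ℂ) ^ (-s) *
            (twistCount K (classGroupCharIdealHom ψ) n * (n : ℂ) ^ (-s))
        else 0 := by
  classical
  set ν := classGroupCharIdealHom ψ with hν
  have hN1 : 1 ≤ q ^ 4 := Nat.one_le_pow _ _ hq
  have key := sum_Icc_mul_sum_Icc_eq_sum_divisorsAntidiagonal_add
    (fun m => twistMoebius K ν m * (m : ℂ) ^ (-s)) (fun n => twistCount K ν n * (n : ℂ) ^ (-s))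
    (q ^ 4)
  -- the Möbius part equals `1`
  have hl : ∀ l ∈ Finset.Icc 1 (q ^ 4), ∑ p ∈ l.divisorsAntidiagonal,
      twistMoebius K ν p.1 * (p.1 : ℂ) ^ (-s) * (twistCount K ν p.2 * (p.2 : ℂ) ^ (-s)) =
        if l = 1 then 1 else 0 := by
    intro l hl
    rw [Finset.mem_Icc] at hl
    have hl0 : l ≠ 0 := by omega
    have hterm : ∀ p ∈ l.divisorsAntidiagonal,
        twistMoebius K ν p.1 * (p.1 : ℂ) ^ (-s) * (twistCount K ν p.2 * (p.2 : ℂ) ^ (-s)) =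
          twistMoebius K ν p.1 * twistCount K ν p.2 * (l : ℂ) ^ (-s) := by
      intro p hp
      rw [← (Nat.mem_divisorsAntidiagonal.mp hp).1, Nat.cast_mul, natCast_mul_natCast_cpow]
      ring
    rw [Finset.sum_congr rfl hterm, ← Finset.sum_mul,
      sum_divisorsAntidiagonal_twistMoebius_mul_twistCount hl0]
    split_ifs with h1
    · rw [h1, Nat.cast_one, one_cpow, one_mul]
    · rw [zero_mul]
  unfold shortInvSum shortLSum
  rw [key, Finset.sum_congr rfl hl, Finset.sum_ite_eq' (Finset.Icc 1 (q ^ 4)) 1 (fun _ => (1 : ℂ)),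
    if_pos (Finset.mem_Icc.mpr ⟨le_rfl, hN1⟩)]

/-- **`B(s)` with the merged power `(mn)^{−s}`**: for natural `m, n`,
`λ*(m) m^{−s} · λ(n) n^{−s} = λ*(m)λ(n)(mn)^{−s}` termwise, so
`M(s)N(s) = 1 + Σ_{m,n ≤ q⁴, mn > q⁴} λ*(m)λ(n)(mn)^{−s}` exactly as printed in (9.5)–p. 20 L1–4.
[cite: ConreyIwaniec2002, §9 p. 20 L1–4] -/
theorem shortInvSum_mul_shortLSum_eq_one_add' (ψ : ClassGroup (𝓞 K) →* ℂˣ) (q : ℕ) (hq : 0 < q)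
    (s : ℂ) :
    shortInvSum K ψ q s * shortLSum K ψ q s =
      1 + ∑ m ∈ Finset.Icc 1 (q ^ 4), ∑ n ∈ Finset.Icc 1 (q ^ 4),
        if q ^ 4 < m * n then
          twistMoebius K (classGroupCharIdealHom ψ) m * twistCount K (classGroupCharIdealHom ψ) n *
            ((m * n : ℕ) : ℂ) ^ (-s)
        else 0 := by
  rw [shortInvSum_mul_shortLSum_eq_one_add K ψ q hq s]
  congr 1
  refine Finset.sum_congr rfl fun m _ => Finset.sum_congr rfl fun n _ => ?_
  split_ifs
  · rw [Nat.cast_mul, natCast_mul_natCast_cpow]; ring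
  · rfl

end ConreyIwaniec2002

end Literature.NumberTheory.LFunctions

end
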